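import Mathlib

/-!
# SoloBlindOffDiagTranspose — the Gross regulator and the tested matrix `M̃` have the SAME determinant (all k)

Side programme O1b, s127 (THEOREM G ⟹ DETERMINANT LAW, every k; corrects proof_ix §7b).
THEOREM G (s126) expresses the weight-2 Stickelberger element `θ̄_N` at squarefree level
`N = q₁⋯q_k` (all `qᵢ ≡ 1 (mod ℓ)`) as `ζ(−1)·det A`, where the Gross regulator `A = −N` has the
diagonal of the tested matrix `M̃` (`M̃ᵢᵢ = −12mᵢxᵢ − Σ_{j≠i} ψ_j(qᵢ)x_j`) but the OFF-DIAGONAL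
PATTERN TRANSPOSED: `Nᵢⱼ = Γⱼᵢ·xⱼ` versus `M̃ᵢⱼ = Γᵢⱼ·xⱼ`.  The kernel below proves, for every finite
index type and every commutative ring, that such a transposition does not change the determinant
AT ALL (not only its top coefficient): for any diagonal `d`, any `B` and any column weights `x`,
`det[i = j ↦ dᵢ ; i ≠ j ↦ Bᵢⱼ·xⱼ] = det[i = j ↦ dᵢ ; i ≠ j ↦ Bⱼᵢ·xⱼ]`.
Proof: in the Leibniz expansion pair `σ` with `σ⁻¹`; the off-diagonal monomial of the `σ`-term is
`∏_{i ∉ Fix σ} xᵢ` for every `σ` (a permutation maps its non-fixed set onto itself), so the two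
terms agree.  Consequently `det A = (−1)^k det M̃(Y)` and THEOREM G reads
`θ̄_N ≡ −(1/12)(−1)^k·det M̃(Y) (mod ℓ, I^{k+1})` coefficient by coefficient.
* `soloBlind_prod_nonfixed_comp` — `∏_{σ i ≠ i} x (σ i) = ∏_{σ i ≠ i} x i`;
* `soloBlind_det_offDiagTranspose` — the determinant identity;
* `soloBlind_det_offDiagTranspose_two` — the k = 2 instance checked by `ring` independently.
-/

namespace Summit.Langlands.Langlands.Theorems

/-- A permutation maps its set of non-fixed points onto itself: the product of `x (σ i)` over the
non-fixed `i` equals the product of `x i` over the non-fixed `i` (written with `if` so that no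
`Finset.filter` bookkeeping is needed). -/
theorem soloBlind_prod_nonfixed_comp {n R : Type*} [Fintype n] [DecidableEq n] [CommMonoid R]
    (σ : Equiv.Perm n) (x : n → R) :
    (∏ i, if σ i = i then (1 : R) else x (σ i)) = ∏ i, if σ i = i then (1 : R) else x i := by
  have h : (fun i => if σ i = i then (1 : R) else x (σ i))
      = fun i => (fun j => if σ j = j then (1 : R) else x j) (σ i) := by
    funext i
    simp only [EmbeddingLike.apply_eq_iff_eq]
  rw [h, Equiv.prod_comp σ (fun j => if σ j = j then (1 : R) else x j)]

/-- Off-diagonal transposition does not change the determinant of a matrix of the Gross-regulator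
shape `(i = j ↦ d i ; i ≠ j ↦ B i j * x j)`. -/
theorem soloBlind_det_offDiagTranspose {n R : Type*} [Fintype n] [DecidableEq n] [CommRing R]
    (B : Matrix n n R) (d x : n → R) :
    (Matrix.of fun i j => if i = j then d i else B i j * x j).det
      = (Matrix.of fun i j => if i = j then d i else B j i * x j).det := by
  rw [Matrix.det_apply', Matrix.det_apply']
  refine Fintype.sum_equiv (Equiv.inv (Equiv.Perm n)) _ _ (fun σ => ?_)
  rw [Equiv.inv_apply, Equiv.Perm.sign_inv]
  congr 1
  simp only [Matrix.of_apply]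
  -- left: split each factor into its `B/d`-part and its `x`-part
  have e1 : (∏ i, (if σ i = i then d (σ i) else B (σ i) i * x i))
      = (∏ i, (if σ i = i then d i else B (σ i) i)) * ∏ i, (if σ i = i then (1 : R) else x i) := by
    rw [← Finset.prod_mul_distrib]
    refine Finset.prod_congr rfl fun i _ => ?_
    by_cases h : σ i = i <;> simp [h]
  -- right: re-index the product by `i ↦ σ i`
  have e2 : (∏ i, (if σ⁻¹ i = i then d (σ⁻¹ i) else B i (σ⁻¹ i) * x i))
      = ∏ i, (if σ i = i then d i else B (σ i) i * x (σ i)) := by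
    refine Fintype.prod_equiv σ⁻¹ _ _ (fun i => ?_)
    simp only [Equiv.Perm.coe_inv, Equiv.apply_symm_apply]
    by_cases h : σ.symm i = i
    · simp [h]
    · have h' : ¬ (i = σ.symm i) := fun e => h e.symm
      simp [h, h']
  have e3 : (∏ i, (if σ i = i then d i else B (σ i) i * x (σ i)))
      = (∏ i, (if σ i = i then d i else B (σ i) i)) * ∏ i, (if σ i = i then (1 : R) else x (σ i)) := by
    rw [← Finset.prod_mul_distrib]
    refine Finset.prod_congr rfl fun i _ => ?_
    by_cases h : σ i = i <;> simp [h]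
  rw [e1, e2, e3, soloBlind_prod_nonfixed_comp σ x]

/-- The k = 2 instance, checked independently by `ring` (E80's `soloBlind_detLaw_two` shape). -/
theorem soloBlind_det_offDiagTranspose_two {R : Type*} [CommRing R] (d1 d2 B12 B21 x1 x2 : R) :
    Matrix.det !![d1, B12 * x2; B21 * x1, d2] = Matrix.det !![d1, B21 * x2; B12 * x1, d2] := by
  simp [Matrix.det_fin_two]
  ring

end Summit.Langlands.Langlands.Theorems
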